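import Literature.Topology.FourManifolds.TrisectionsSectorRecognition
import HarnessLib

/-!
# Gluing the implant into the manifold: the modified normal coordinates and the modified sets

Topic `Literature/Topology/FourManifolds`; infrastructure for the fact seat
`provefact-Literature.Topology.FourManifolds.exists-14560f9fc8` (named fact (c′)
`Literature.Topology.FourManifolds.exists_stabilized_gkTrisection`, Gay–Kirby 2016, Def. 8 and
Lemma 10).  Everything in this file is **proved**; no definitions, no named facts.

The implant model (`TrisectionsImplantModel.lean`) lives on `ℝ⁴`; it is transported into the
closed `4`-manifold `X` through a chart `Θ` of the maximal atlas in which the old normal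
coordinates are `u = (x₃ - x₀)/2`, `v = (-x₃ - x₀)/2`.  The **glued coordinates** are
`u' = Θ.source.piecewise (ũ ∘ Θ) u`, `v' = Θ.source.piecewise (ṽ ∘ Θ) v` for model functions
`ũ, ṽ` equal to the model normal coordinates off a compact `Kb ⊆ Θ.target`; the **modified
sets** are `S' = {y | (y ∈ U ∧ P (u' y) (v' y)) ∨ (y ∉ U ∧ y ∈ S)}` for the closed wedge
condition `P` describing `S` inside `U`.  This file proves the bookkeeping: `u', v'` are
smooth and equal to `u, v` off the compact `KX = Θ⁻¹(Kb)`; `S'` agrees with `S` off `KX`, is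
described by `P (u', v')` in `U`, is closed and compact; the three modified sets cover `X` and
meet in the new corner locus `F' = {u' = v' = 0} ∩ U`, which is compact.

## References

* D. Gay, R. Kirby, *Trisecting 4-manifolds*, Geom. Topol. 20 (2016) 3097–3132, Def. 8.
  [GayKirby2016]
-/

open scoped Manifold ContDiff Topology Classical
open Set Function Filter

noncomputable section

namespace Literature.Topology.FourManifolds

universe u

section Glue

variable {X : Type u} [TopologicalSpace X]

/-! ### The glued normal coordinates -/

/-- **The glued coordinate agrees with the old one off the implant.**  Let `Θ` be a chart with
`w = m ∘ Θ` on its source (`m` the model coordinate) and `wN` a model function equal to `m`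
off a compact `Kb ⊆ Θ.target`.  Then `w' = Θ.source.piecewise (wN ∘ Θ) w` equals `wN ∘ Θ`
on the source and `w` off `KX = Θ.symm '' Kb`. [folklore] -/
theorem piecewise_eq_of_not_mem {Θ : OpenPartialHomeomorph X (EuclideanSpace ℝ (Fin 4))}
    {w : X → ℝ} {m wN : EuclideanSpace ℝ (Fin 4) → ℝ} (hw : ∀ y ∈ Θ.source, w y = m (Θ y))
    {Kb : Set (EuclideanSpace ℝ (Fin 4))} (hwN : ∀ z ∉ Kb, wN z = m z)
    {y : X} (hy : y ∉ Θ.symm '' Kb) :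
    Θ.source.piecewise (wN ∘ Θ) w y = w y := by
  by_cases hysrc : y ∈ Θ.source
  · rw [piecewise_eq_of_mem _ _ _ hysrc, comp_apply, hw y hysrc]
    apply hwN
    intro hK
    exact hy ⟨Θ y, hK, Θ.left_inv hysrc⟩
  · exact piecewise_eq_of_notMem _ _ _ hysrc

/-- The glued coordinate on the source of the chart. [folklore] -/
theorem piecewise_eq_of_mem_source {Θ : OpenPartialHomeomorph X (EuclideanSpace ℝ (Fin 4))}
    {w : X → ℝ} {wN : EuclideanSpace ℝ (Fin 4) → ℝ} {y : X} (hy : y ∈ Θ.source) :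
    Θ.source.piecewise (wN ∘ Θ) w y = wN (Θ y) := by
  exact piecewise_eq_of_mem _ _ _ hy

/-- `KX = Θ.symm '' Kb` is compact and contained in the source. [folklore] -/
theorem isCompact_symm_image {Θ : OpenPartialHomeomorph X (EuclideanSpace ℝ (Fin 4))}
    {Kb : Set (EuclideanSpace ℝ (Fin 4))} (hKb : IsCompact Kb) (hKbT : Kb ⊆ Θ.target) :
    IsCompact (Θ.symm '' Kb) ∧ Θ.symm '' Kb ⊆ Θ.source :=
  ⟨hKb.image_of_continuousOn (Θ.continuousOn_symm.mono hKbT),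
    by rintro _ ⟨z, hz, rfl⟩; exact Θ.map_target (hKbT hz)⟩

/-- **The glued coordinate is smooth** (`Θ` a chart of the maximal atlas, `wN` smooth, `w`
smooth): on the source it is `wN ∘ Θ`, off the compact `KX` it is `w`. [folklore] -/
theorem contMDiff_piecewise [T2Space X] [ChartedSpace (EuclideanSpace ℝ (Fin 4)) X]
    [IsManifold (𝓡 4) ∞ X]
    {Θ : OpenPartialHomeomorph X (EuclideanSpace ℝ (Fin 4))}
    (hΘ : Θ ∈ IsManifold.maximalAtlas (𝓡 4) ∞ X)
    {w : X → ℝ} (hws : ContMDiff (𝓡 4) 𝓘(ℝ, ℝ) ∞ w) {m wN : EuclideanSpace ℝ (Fin 4) → ℝ}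
    (hwNs : ContDiff ℝ ∞ wN) (hw : ∀ y ∈ Θ.source, w y = m (Θ y))
    {Kb : Set (EuclideanSpace ℝ (Fin 4))} (hKb : IsCompact Kb) (hKbT : Kb ⊆ Θ.target)
    (hwN : ∀ z ∉ Kb, wN z = m z) :
    ContMDiff (𝓡 4) 𝓘(ℝ, ℝ) ∞ (Θ.source.piecewise (wN ∘ Θ) w) := by
  obtain ⟨hKXc, hKXsrc⟩ := isCompact_symm_image (Θ := Θ) hKb hKbT
  intro y
  by_cases hysrc : y ∈ Θ.source
  · have heq : Θ.source.piecewise (wN ∘ Θ) w =ᶠ[𝓝 y] (wN ∘ Θ) := by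
      filter_upwards [Θ.open_source.mem_nhds hysrc] with z hz using piecewise_eq_of_mem _ _ _ hz
    refine ContMDiffAt.congr_of_eventuallyEq ?_ heq
    have h1 : ContMDiffAt (𝓡 4) 𝓘(ℝ, EuclideanSpace ℝ (Fin 4)) ∞ Θ y :=
      (contMDiffOn_of_mem_maximalAtlas hΘ).contMDiffAt (Θ.open_source.mem_nhds hysrc)
    exact ((contMDiff_iff_contDiff.2 hwNs).contMDiffAt).comp y h1
  · have hyK : y ∉ Θ.symm '' Kb := fun h => hysrc (hKXsrc h)
    have heq : Θ.source.piecewise (wN ∘ Θ) w =ᶠ[𝓝 y] w := by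
      filter_upwards [hKXc.isClosed.isOpen_compl.mem_nhds hyK] with z hz using
        piecewise_eq_of_not_mem hw hwN hz
    exact (hws y).congr_of_eventuallyEq heq

/-- The glued coordinate agrees with the old one on the closure of the complement of `KX`
(both are continuous). [folklore] -/
theorem eq_of_mem_closure_compl [T2Space X]
    {w w' : X → ℝ} (hwc : Continuous w) (hw'c : Continuous w') {KX : Set X}
    (heq : ∀ y ∉ KX, w' y = w y) {y : X} (hy : y ∈ closure KXᶜ) : w' y = w y := by
  have h : EqOn w' w (closure KXᶜ) := EqOn.closure (fun z hz => heq z hz) hw'c hwc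
  exact h hy

end Glue

section Sets

variable {X : Type u}

/-! ### The modified sets -/

/-- **The modified set is described by the wedge condition in `U`.** [folklore] -/
theorem mem_modifiedSet_iff_of_mem {U S : Set X} {P : ℝ → ℝ → Prop} {u' v' : X → ℝ} {y : X}
    (hy : y ∈ U) :
    y ∈ {y | (y ∈ U ∧ P (u' y) (v' y)) ∨ (y ∉ U ∧ y ∈ S)} ↔ P (u' y) (v' y) := by
  simp only [mem_setOf_eq]
  constructor
  · rintro (⟨-, h⟩ | ⟨h, -⟩)
    · exact h
    · exact absurd hy h
  · intro h; exact Or.inl ⟨hy, h⟩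

/-- **Off the implant the modified set is the old set.** [folklore] -/
theorem mem_modifiedSet_iff_of_not_mem {U S KX : Set X} {P : ℝ → ℝ → Prop} {u v u' v' : X → ℝ}
    (hS : ∀ y ∈ U, y ∈ S ↔ P (u y) (v y)) (hu : ∀ y ∉ KX, u' y = u y)
    (hv : ∀ y ∉ KX, v' y = v y) {y : X} (hy : y ∉ KX) :
    y ∈ {y | (y ∈ U ∧ P (u' y) (v' y)) ∨ (y ∉ U ∧ y ∈ S)} ↔ y ∈ S := by
  by_cases hyU : y ∈ U
  · rw [mem_modifiedSet_iff_of_mem hyU, hu y hy, hv y hy, hS y hyU]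
  · simp only [mem_setOf_eq]
    constructor
    · rintro (⟨h, -⟩ | ⟨-, h⟩)
      · exact absurd h hyU
      · exact h
    · intro h; exact Or.inr ⟨hyU, h⟩

/-- The modified set lies in `S ∪ KX`. [folklore] -/
theorem modifiedSet_subset {U S KX : Set X} {P : ℝ → ℝ → Prop} {u v u' v' : X → ℝ}
    (hS : ∀ y ∈ U, y ∈ S ↔ P (u y) (v y)) (hu : ∀ y ∉ KX, u' y = u y)
    (hv : ∀ y ∉ KX, v' y = v y) :
    {y | (y ∈ U ∧ P (u' y) (v' y)) ∨ (y ∉ U ∧ y ∈ S)} ⊆ S ∪ KX := by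
  intro y hy
  by_cases hyK : y ∈ KX
  · exact Or.inr hyK
  · exact Or.inl ((mem_modifiedSet_iff_of_not_mem hS hu hv hyK).1 hy)

variable [TopologicalSpace X]

/-- **The modified set is closed** (`S` closed, `KX ⊆ U` compact, the wedge condition closed,
`u', v'` continuous and equal to `u, v` off `KX`). [folklore] -/
theorem isClosed_modifiedSet [T2Space X] {U S KX : Set X} (hS : IsClosed S)
    (hKX : IsCompact KX) (hKXU : KX ⊆ U) {P : ℝ → ℝ → Prop}
    (hP : IsClosed {p : ℝ × ℝ | P p.1 p.2}) {u v u' v' : X → ℝ}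
    (huc : Continuous u) (hvc : Continuous v) (hu'c : Continuous u') (hv'c : Continuous v')
    (hSd : ∀ y ∈ U, y ∈ S ↔ P (u y) (v y)) (hu : ∀ y ∉ KX, u' y = u y)
    (hv : ∀ y ∉ KX, v' y = v y) :
    IsClosed {y | (y ∈ U ∧ P (u' y) (v' y)) ∨ (y ∉ U ∧ y ∈ S)} := by
  set S' : Set X := {y | (y ∈ U ∧ P (u' y) (v' y)) ∨ (y ∉ U ∧ y ∈ S)} with hS'
  -- the two pieces
  have hP' : IsClosed {y : X | P (u' y) (v' y)} :=
    hP.preimage (hu'c.prodMk hv'c)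
  have h1 : S' = (KX ∩ {y | P (u' y) (v' y)}) ∪ (S ∩ KXᶜ) := by
    ext y
    by_cases hyK : y ∈ KX
    · rw [hS', mem_modifiedSet_iff_of_mem (hKXU hyK)]
      simp only [mem_union, mem_inter_iff, mem_setOf_eq, mem_compl_iff, hyK, true_and, not_true,
        and_false, or_false]
    · rw [hS', mem_modifiedSet_iff_of_not_mem hSd hu hv hyK]
      simp only [mem_union, mem_inter_iff, mem_setOf_eq, mem_compl_iff, hyK, false_and,
        not_false_eq_true, and_true, false_or]
  rw [← closure_subset_iff_isClosed, h1, closure_union]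
  apply union_subset
  · rw [(hKX.isClosed.inter hP').closure_eq]
    exact subset_union_left
  · intro y hy
    have hyS : y ∈ S := closure_minimal inter_subset_left hS hy
    have hycl : y ∈ closure KXᶜ := closure_mono inter_subset_right hy
    by_cases hyK : y ∈ KX
    · left
      refine ⟨hyK, ?_⟩
      have hu' := eq_of_mem_closure_compl huc hu'c hu hycl
      have hv' := eq_of_mem_closure_compl hvc hv'c hv hycl
      show P (u' y) (v' y)
      rw [hu', hv']
      exact (hSd y (hKXU hyK)).1 hyS
    · right; exact ⟨hyS, hyK⟩

/-- **The modified set is compact.** [folklore] -/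
theorem isCompact_modifiedSet [T2Space X] {U S KX : Set X} (hS : IsCompact S)
    (hKX : IsCompact KX) (hKXU : KX ⊆ U) {P : ℝ → ℝ → Prop}
    (hP : IsClosed {p : ℝ × ℝ | P p.1 p.2}) {u v u' v' : X → ℝ}
    (huc : Continuous u) (hvc : Continuous v) (hu'c : Continuous u') (hv'c : Continuous v')
    (hSd : ∀ y ∈ U, y ∈ S ↔ P (u y) (v y)) (hu : ∀ y ∉ KX, u' y = u y)
    (hv : ∀ y ∉ KX, v' y = v y) :
    IsCompact {y | (y ∈ U ∧ P (u' y) (v' y)) ∨ (y ∉ U ∧ y ∈ S)} :=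
  (hS.union hKX).of_isClosed_subset
    (isClosed_modifiedSet hS.isClosed hKX hKXU hP huc hvc hu'c hv'c hSd hu hv)
    (modifiedSet_subset hSd hu hv)

omit [TopologicalSpace X] in
/-- **The three modified sets cover `X`** if the three wedge conditions cover the plane and the
old sets cover `X`. [folklore] -/
theorem iUnion_modifiedSet_eq_univ {U : Set X} {S : Fin 3 → Set X} {P : Fin 3 → ℝ → ℝ → Prop}
    {u' v' : X → ℝ} (hcov : ∀ a b : ℝ, ∃ m, P m a b) (hold : (⋃ m, S m) = univ) :
    (⋃ m, {y | (y ∈ U ∧ P m (u' y) (v' y)) ∨ (y ∉ U ∧ y ∈ S m)}) = univ := by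
  apply eq_univ_of_forall
  intro y
  by_cases hyU : y ∈ U
  · obtain ⟨m, hm⟩ := hcov (u' y) (v' y)
    exact mem_iUnion.2 ⟨m, Or.inl ⟨hyU, hm⟩⟩
  · have : y ∈ ⋃ m, S m := by rw [hold]; trivial
    obtain ⟨m, hm⟩ := mem_iUnion.1 this
    exact mem_iUnion.2 ⟨m, Or.inr ⟨hyU, hm⟩⟩

omit [TopologicalSpace X] in
/-- **The new corner locus.**  If the three wedge conditions meet exactly in the origin and the
old corner locus `⋂ S m` lies in `U`, the three modified sets meet in
`F' = {y ∈ U | u' y = 0 ∧ v' y = 0}`. [folklore] -/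
theorem iInter_modifiedSet_eq {U : Set X} {S : Fin 3 → Set X} {P : Fin 3 → ℝ → ℝ → Prop}
    {u' v' : X → ℝ} (hmeet : ∀ a b : ℝ, (∀ m, P m a b) ↔ a = 0 ∧ b = 0)
    (hFU : (⋂ m, S m) ⊆ U) :
    (⋂ m, {y | (y ∈ U ∧ P m (u' y) (v' y)) ∨ (y ∉ U ∧ y ∈ S m)}) =
      {y | y ∈ U ∧ u' y = 0 ∧ v' y = 0} := by
  ext y
  simp only [mem_iInter, mem_setOf_eq]
  constructor
  · intro h
    by_cases hyU : y ∈ U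
    · refine ⟨hyU, (hmeet _ _).1 fun m => ?_⟩
      rcases h m with ⟨-, hm⟩ | ⟨hn, -⟩
      · exact hm
      · exact absurd hyU hn
    · exfalso
      apply hyU
      apply hFU
      refine mem_iInter.2 fun m => ?_
      rcases h m with ⟨hU', -⟩ | ⟨-, hm⟩
      · exact absurd hU' hyU
      · exact hm
  · rintro ⟨hyU, hu0, hv0⟩ m
    exact Or.inl ⟨hyU, ((hmeet _ _).2 ⟨hu0, hv0⟩) m⟩

omit [TopologicalSpace X] in
/-- The new corner locus lies in the old one union `KX`. [folklore] -/
theorem newCorner_subset {U KX : Set X} {F : Set X} {u v u' v' : X → ℝ}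
    (hF : ∀ y ∈ U, y ∈ F ↔ u y = 0 ∧ v y = 0) (hu : ∀ y ∉ KX, u' y = u y)
    (hv : ∀ y ∉ KX, v' y = v y) :
    {y | y ∈ U ∧ u' y = 0 ∧ v' y = 0} ⊆ F ∪ KX := by
  rintro y ⟨hyU, hu0, hv0⟩
  by_cases hyK : y ∈ KX
  · exact Or.inr hyK
  · left
    rw [hu y hyK] at hu0
    rw [hv y hyK] at hv0
    exact (hF y hyU).2 ⟨hu0, hv0⟩

/-- **The new corner locus is compact** (closed in the compact `F ∪ KX ⊆ U`). [folklore] -/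
theorem isCompact_newCorner [T2Space X] {U KX F : Set X} (hFc : IsCompact F) (hFU : F ⊆ U)
    (hKX : IsCompact KX) (hKXU : KX ⊆ U) {u v u' v' : X → ℝ}
    (hu'c : Continuous u') (hv'c : Continuous v')
    (hF : ∀ y ∈ U, y ∈ F ↔ u y = 0 ∧ v y = 0) (hu : ∀ y ∉ KX, u' y = u y)
    (hv : ∀ y ∉ KX, v' y = v y) :
    IsCompact {y | y ∈ U ∧ u' y = 0 ∧ v' y = 0} := by
  have heq : {y | y ∈ U ∧ u' y = 0 ∧ v' y = 0} = (F ∪ KX) ∩ {y | u' y = 0 ∧ v' y = 0} := by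
    ext y
    constructor
    · intro hy
      exact ⟨newCorner_subset hF hu hv hy, hy.2⟩
    · rintro ⟨hyFK, hy⟩
      have hyU : y ∈ U := by
        rcases hyFK with h | h
        · exact hFU h
        · exact hKXU h
      exact ⟨hyU, hy⟩
  rw [heq]
  refine (hFc.union hKX).inter_right ?_
  exact (isClosed_eq hu'c continuous_const).inter (isClosed_eq hv'c continuous_const)

omit [TopologicalSpace X] in
/-- Off `KX` the new corner locus is the old one. [folklore] -/
theorem mem_newCorner_iff_of_not_mem {U KX F : Set X} {u v u' v' : X → ℝ} (hFU : F ⊆ U)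
    (hF : ∀ y ∈ U, y ∈ F ↔ u y = 0 ∧ v y = 0) (hu : ∀ y ∉ KX, u' y = u y)
    (hv : ∀ y ∉ KX, v' y = v y) {y : X} (hy : y ∉ KX) :
    y ∈ {y | y ∈ U ∧ u' y = 0 ∧ v' y = 0} ↔ y ∈ F := by
  simp only [mem_setOf_eq, hu y hy, hv y hy]
  constructor
  · rintro ⟨hyU, h0⟩; exact (hF y hyU).2 h0
  · intro hyF; exact ⟨hFU hyF, (hF y (hFU hyF)).1 hyF⟩

end Sets

end Literature.Topology.FourManifolds
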